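import Summits.NavierStokesRegularity.FluidComputer.PalasekTowerLundgrenChildGaussianHandover
import Summits.NavierStokesRegularity.FluidComputer.PalasekTowerLundgrenChildSwirlBurgersBracketNonneg
import Literature.Analysis.FluidPDE.PlanarLambOseen

/-!
# REGISTER v2.3″ (continued): THE GAUSSIAN HAND-OVER INHABITED — the planar Oseen run of heat age
# `1/(2N₁²)` seeds a Lundgren child meeting the level-`1` core clause after thirteen strain times
# (tuned rates, every schedule; NO planar-run hypothesis left)

Cell `ns-blowup`, seat `ns-blowup-ecbridge-8` (g11); evidence toward crux stmt-NavierStokesRegularity-20305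
`HeredityFromTwoT` (standing record 19250), floor `CoreFloorAt k`, MODEL lane «child core = cross-section of
Lundgren's stretched flow in the host strain `c = λA_k` at `ν = 1`». The g10 file
`PalasekTowerLundgrenChildGaussianHandover` priced the co-signed core clock for a Gaussian hand-over but kept
the planar run abstract: its theorems quantify over a classical planar Navier–Stokes run `v` on a convex time
set with `v = K₂ ∗ ω̃`, uniformly rapidly decaying vorticity, and `ω̃(0)` the heat Gaussian of age `a`
(hypotheses `hv`, `hω`, `hBS`, `hinit`, plus a passive axial scalar `hw` and the window map `hmaps`).
Literature now holds that run — the planar Oseen vortex started at heat age `a`,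
`Literature.Analysis.FluidPDE.PlanarLambOseen` (Gallay–Wayne 2005 §1: classical planar solution on `[0, T]`,
`ṽ = K₂ ∗ ω̃`, uniformly Schwartz vorticity on compact slabs, `ω̃(0) = (Γ/4πa)e^{−|η|²/4a}`). This file
DISCHARGES every planar-run hypothesis of the g10 statements with it:

* `palasekTowerBreakdown_oseenRun_child_coreClause_logClock` — any rates `R`, any schedule, any level `k`,
  any `λ > 0` with `x_k = λN_k^{β−2b} ≥ 1.95`, any heat age `a > 0`: the Lundgren child seeded by the
  planar Oseen run of age `a` (axial scalar `0`) meets the level-`(k+1)` core clause at every strain time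
  `s > 0` with **`3200·(aλA_k − 1 − log(aλA_k)) ≤ e^{λA_k s}`**, provided `Γ ≥ 0.86·c₁N_{k+1}^{β−2}`;
* `palasekTowerBreakdown_oseenRun_child_coreClause_tuned_zero` — **`TowerRates.tuned`, level `0`, `λ = 1`,
  heat age `1/(2N₁²)` (standard deviation = the core-ledger radius): for EVERY schedule and every
  `Γ ≥ 0.86·c₁N₁^{β−2}`, the Oseen-seeded child meets the level-`1` core clause at every strain time `s`
  with `A₀ s ≥ 13`** — thirteen of the `169.8` strain times of window `0`. The only hypotheses left are the
  schedule, the circulation endowment `Γ` and the cross-section height `|z₀| ≤ radius`;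
* `palasekTowerBreakdown_oseenRun_child_coreClause_tuned_allLevels` (§5, appended) — **`TowerRates.tuned`, EVERY
  level `k`, `λ = 1`, heat age `1/(2N_{k+1}²)`, every schedule: `A_k s ≥ 13·(33/32)^k ∧ Γ ≥ 0.86·c₁N_{k+1}^{β−2}`
  ⇒ the level-`(k+1)` core clause** (`x_k = 2^{8.1·(33/32)^k}`, `1600·2^{8.1t} ≤ e^{13t}` for `t ≥ 1`) — a
  LEVEL-INDEPENDENT `7.7 %` of the window budget `169.85·(33/32)^k`, the form relevant to `HeredityFromTwoT` (`k ≥ 2`);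
* `palasekTowerBreakdown_oseenRun_childSwirl_burgersBracket` — the SPEED face for the same child (any rates):
  with `K = aλA_k − 1 − log(aλA_k)`, once `0.52·(2K)^{1/4} ≤ δe^{λA_k s/4}` (`λA_k s ≥ 1`) the child swirl is
  `≤ (0.0563 + δ)·Γ√(λA_k)` everywhere and `≥ (0.0502 − δ)·Γ√(λA_k)` somewhere
  (`…cosigned_childSwirl_burgersBracket` with `hv`, `hω`, `hBS`, `h0nn`, `hΓ` discharged).

WHAT THIS IS NOT: not NS about registered flows; no registered `Stage` is constructed (the Oseen-seeded
Lundgren child is the Burgers vortex with relaxing width — for which `PalasekTowerChildCoreLedgerStokes` already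
gives the clause at Burgers width with no clock); the point is that the CO-SIGNED CLASS of the g9/g10
entropy-clock theorems is INHABITED in the kernel with every analytic hypothesis discharged, so those MODEL
statements are not vacuous. The vacuity of the register itself stands and is not used.

## References
* [cite: GallayWayne2005, §1 (the Oseen vortices, display preceding Thm. 1.2); Lemma 3.2 and §3.4]
* [cite: Palasek2026ElementaryModel, §3 (3.2), §3.1] · [cite: Saffman1992, §13.3 eq. (31)]
-/

noncomputable section

namespace Summit.NavierStokesRegularity.FluidComputer.PalasekTowerClayBridge

open Real Set MeasureTheory Function
open scoped RealInnerProductSpace ContDiff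
open Literature.Analysis.FluidPDE Literature.Analysis.FluidPDE.Lundgren Literature.Analysis.Calculus
open CoreLedgerStokes CoreClock

/-! ### §1 The window map lands in a compact planar slab -/

/-- The Lundgren clock `t ↦ (e^{ct} − 1)/c` (`c > 0`) maps the strain-time window `[0, s]` into the planar
slab `[0, (e^{cs} − 1)/c]`. [folklore] -/
private theorem mapsTo_lundgrenClock_Icc {c s : ℝ} (hc : 0 < c) :
    MapsTo (fun t => (exp (c * t) - 1) / c) (Icc 0 s) (Icc 0 ((exp (c * s) - 1) / c)) := by
  intro t ht
  refine ⟨div_nonneg ?_ hc.le, div_le_div_of_nonneg_right ?_ hc.le⟩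
  · have : 1 ≤ exp (c * t) := one_le_exp (by nlinarith [ht.1])
    linarith
  · have : exp (c * t) ≤ exp (c * s) := exp_le_exp.2 (by nlinarith [ht.2])
    linarith

/-! ### §2 The Oseen-seeded child: the log clock with every planar-run hypothesis discharged -/

/-- **THE CO-SIGNED CORE CLOCK FOR THE OSEEN-SEEDED CHILD** (any rates `R`, any schedule, any level `k`, any
`λ > 0` with `x_k = λN_k^{β−2b} ≥ 1.95`, any heat age `a > 0`, any `Γ > 0`): the Lundgren child whose planar
run is the Oseen vortex `σ ↦ ṽ_{Γ,1}(σ + a)` of `Literature.Analysis.FluidPDE.PlanarLambOseen` (classical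
planar Navier–Stokes on `[0, (e^{λA_k s} − 1)/(λA_k)]`, `ṽ = K₂ ∗ ω̃`, uniformly Schwartz vorticity, hand-over
`ω̃(0) = (Γ/4πa)e^{−|η|²/4a}` — ALL DISCHARGED here) and whose axial scalar is `0` satisfies: **if
`3200·(aλA_k − 1 − log(aλA_k)) ≤ e^{λA_k s}` and `Γ ≥ 0.86·c₁N_{k+1}^{β−2}` then the level-`(k+1)` core
clause holds at strain time `s > 0`** on every cross-section `{x₂ = z₀}`, `|z₀| ≤ radius`
(`palasekTowerBreakdown_gaussianHandover_child_coreClause_logClock` with its planar run instantiated). MODEL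
statement; not about any registered flow.
[cite: GallayWayne2005, §1 (the Oseen vortices, display preceding Thm. 1.2), Lemma 3.2 and §3.4; Palasek2026ElementaryModel, §3.1] -/
theorem palasekTowerBreakdown_oseenRun_child_coreClause_logClock (R : TowerRates) (Sch : Schedule R)
    (k : ℕ) {l : ℝ} (hl : 0 < l) {a Γ : ℝ} (ha : 0 < a) (hΓ : 0 < Γ) {s : ℝ} (hs : 0 < s) {z₀ : ℝ}
    (hz₀ : |z₀| ≤ Sch.radius) (hx : 1.95 ≤ l * R.N k ^ (R.β - 2 * R.b))
    (hclock : 3200 * (a * (l * R.A k) - 1 - Real.log (a * (l * R.A k))) ≤ exp (l * R.A k * s))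
    (hC : 0.86 * Sch.c₁ * R.N (k + 1) ^ (R.β - 2) ≤ Γ) :
    ∃ (x' : EuclideanSpace ℝ (Fin 3)) (γ : ℝ → EuclideanSpace ℝ (Fin 3)),
      ‖x'‖ ≤ Sch.radius ∧ ContDiff ℝ 1 γ ∧ γ 0 = γ 1 ∧
      (∀ σ ∈ Icc (0 : ℝ) 1, γ σ ∈ Metric.closedBall x' (1 / R.N (k + 1))) ∧
      (∀ σ ∈ Icc (0 : ℝ) 1, ‖deriv γ σ‖ ≤ 8 * π / R.N (k + 1)) ∧
      Sch.c₁ * R.N (k + 1) ^ (R.β - 2) ≤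
        circulation (velocity (fun _ => l * R.A k)
          (fun t y => exp (l * R.A k * t / 2) •
            PlanarLambOseen.velocity Γ 1 ((exp (l * R.A k * t) - 1) / (l * R.A k) + a)
              (exp (l * R.A k * t / 2) • y))
          (fun t y => exp (-(l * R.A k * t)) •
            (fun (_ : ℝ) (_ : EuclideanSpace ℝ (Fin 2)) => (0 : ℝ))
              ((exp (l * R.A k * t) - 1) / (l * R.A k)) (exp (l * R.A k * t / 2) • y)) s) γ := by
  set c : ℝ := l * R.A k with hc
  have hcpos : 0 < c := mul_pos hl (R.A_pos k)
  set T : ℝ := (exp (c * s) - 1) / c with hT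
  have hTpos : 0 < T := by
    rw [hT]
    refine div_pos ?_ hcpos
    have : 1 < exp (c * s) := Real.one_lt_exp_iff.2 (mul_pos hcpos hs)  -- name?
    linarith
  have hmaps : MapsTo (fun t => (exp (c * t) - 1) / c) (Icc 0 s) (Icc 0 T) := mapsTo_lundgrenClock_Icc hcpos
  have hv := PlanarLambOseen.isClassicalNSSolutionOn_shift_Icc Γ one_pos ha hTpos
  have hω := PlanarLambOseen.hasUniformRapidDecayOn_planarVorticity_shift one_pos ha hTpos Γ
  have hBS := PlanarLambOseen.velocity_shift_eq_biotSavart2D_Icc (α := Γ) one_pos ha T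
  have hinit : ∀ η : EuclideanSpace ℝ (Fin 2),
      PlanarEigenmode.vorticity (PlanarLambOseen.velocity Γ 1 (0 + a)) η =
        Γ / (4 * π * a) * exp (-(‖η‖ ^ 2 / (4 * a))) := by
    intro η
    rw [PlanarLambOseen.vorticity_shift_zero one_ne_zero a η]
    congr 1
    · ring
    · congr 1; ring
  have hw : IsSmoothSpaceTimeOn (Icc 0 T) (fun (_ : ℝ) (_ : EuclideanSpace ℝ (Fin 2)) => (0 : ℝ)) :=
    contDiffOn_const
  exact palasekTowerBreakdown_gaussianHandover_child_coreClause_logClock R Sch k hl (convex_Icc 0 T) hv hω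
    hBS ha hΓ hinit hw hmaps (left_mem_Icc.2 hTpos.le) (right_mem_Icc.2 hs.le) hs.le hz₀ hx hclock hC

/-! ### §3 The tuned level-`0` number: thirteen strain times, every schedule -/

/-- **THIRTEEN STRAIN TIMES AT THE TUNED RATES, UNCONDITIONALLY IN THE PLANAR RUN**
(`TowerRates.tuned = (2^24, 33/32, 12/5, 49/20)`, level `k = 0`, `λ = 1`, EVERY schedule): the Lundgren child
seeded by the planar Oseen run of heat age `a = 1/(2N₁²)` (the ledger-width Gaussian hand-over: standard
deviation = the core-ledger radius `1/N₁`; circulation `Γ > 0`; axial scalar `0`) **meets the level-`1` core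
clause at every strain time `s` with `A₀ s ≥ 13`, provided `Γ ≥ 0.86·c₁N₁^{β−2}`**, on every cross-section
`{x₂ = z₀}`, `|z₀| ≤ radius` — `palasekTowerBreakdown_ledgerGaussian_child_coreClause_tuned_zero` with its
hypotheses `hv`, `hω`, `hBS`, `hinit`, `hw`, `hmaps`, `h0`, `hsS` ALL DISCHARGED by
`Literature.Analysis.FluidPDE.PlanarLambOseen`. Thirteen of the `4b²β log N₀ ∈ (169.8, 169.9)` strain times of
window `0`. MODEL statement; not about any registered flow; no `Stage` constructed.
[cite: GallayWayne2005, §1 (the Oseen vortices, display preceding Thm. 1.2), Lemma 3.2 and §3.4; Palasek2026ElementaryModel, §3 (3.2), §3.1] -/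
theorem palasekTowerBreakdown_oseenRun_child_coreClause_tuned_zero (Sch : Schedule TowerRates.tuned)
    {Γ : ℝ} (hΓ : 0 < Γ) {s : ℝ} (hs13 : 13 ≤ TowerRates.tuned.A 0 * s) {z₀ : ℝ}
    (hz₀ : |z₀| ≤ Sch.radius)
    (hC : 0.86 * Sch.c₁ * TowerRates.tuned.N (0 + 1) ^ (TowerRates.tuned.β - 2) ≤ Γ) :
    ∃ (x' : EuclideanSpace ℝ (Fin 3)) (γ : ℝ → EuclideanSpace ℝ (Fin 3)),
      ‖x'‖ ≤ Sch.radius ∧ ContDiff ℝ 1 γ ∧ γ 0 = γ 1 ∧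
      (∀ σ ∈ Icc (0 : ℝ) 1, γ σ ∈ Metric.closedBall x' (1 / TowerRates.tuned.N (0 + 1))) ∧
      (∀ σ ∈ Icc (0 : ℝ) 1, ‖deriv γ σ‖ ≤ 8 * π / TowerRates.tuned.N (0 + 1)) ∧
      Sch.c₁ * TowerRates.tuned.N (0 + 1) ^ (TowerRates.tuned.β - 2) ≤
        circulation (velocity (fun _ => 1 * TowerRates.tuned.A 0)
          (fun t y => exp (1 * TowerRates.tuned.A 0 * t / 2) •
            PlanarLambOseen.velocity Γ 1
              ((exp (1 * TowerRates.tuned.A 0 * t) - 1) / (1 * TowerRates.tuned.A 0) +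
                1 / (2 * TowerRates.tuned.N (0 + 1) ^ 2))
              (exp (1 * TowerRates.tuned.A 0 * t / 2) • y))
          (fun t y => exp (-(1 * TowerRates.tuned.A 0 * t)) •
            (fun (_ : ℝ) (_ : EuclideanSpace ℝ (Fin 2)) => (0 : ℝ))
              ((exp (1 * TowerRates.tuned.A 0 * t) - 1) / (1 * TowerRates.tuned.A 0))
              (exp (1 * TowerRates.tuned.A 0 * t / 2) • y)) s) γ := by
  have hA := TowerRates.tuned.A_pos 0
  have hN1 := TowerRates.tuned.N_pos (0 + 1)
  have hs : 0 < s := by nlinarith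
  set c : ℝ := 1 * TowerRates.tuned.A 0 with hc
  have hcpos : 0 < c := by rw [hc, one_mul]; exact hA
  set a : ℝ := 1 / (2 * TowerRates.tuned.N (0 + 1) ^ 2) with ha
  have hapos : 0 < a := by rw [ha]; positivity
  set T : ℝ := (exp (c * s) - 1) / c with hT
  have hTpos : 0 < T := by
    rw [hT]
    refine div_pos ?_ hcpos
    have : 1 < exp (c * s) := Real.one_lt_exp_iff.2 (mul_pos hcpos hs)
    linarith
  have hmaps : MapsTo (fun t => (exp (c * t) - 1) / c) (Icc 0 s) (Icc 0 T) := mapsTo_lundgrenClock_Icc hcpos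
  have hv := PlanarLambOseen.isClassicalNSSolutionOn_shift_Icc Γ one_pos hapos hTpos
  have hω := PlanarLambOseen.hasUniformRapidDecayOn_planarVorticity_shift one_pos hapos hTpos Γ
  have hBS := PlanarLambOseen.velocity_shift_eq_biotSavart2D_Icc (α := Γ) one_pos hapos T
  have hinit : ∀ η : EuclideanSpace ℝ (Fin 2),
      PlanarEigenmode.vorticity (PlanarLambOseen.velocity Γ 1 (0 + a)) η =
        Γ / (4 * π * (1 / (2 * TowerRates.tuned.N (0 + 1) ^ 2))) *
          exp (-(‖η‖ ^ 2 / (4 * (1 / (2 * TowerRates.tuned.N (0 + 1) ^ 2))))) := by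
    intro η
    rw [PlanarLambOseen.vorticity_shift_zero one_ne_zero a η, ha]
    congr 1
    · ring
    · congr 1; ring
  have hw : IsSmoothSpaceTimeOn (Icc 0 T) (fun (_ : ℝ) (_ : EuclideanSpace ℝ (Fin 2)) => (0 : ℝ)) :=
    contDiffOn_const
  exact palasekTowerBreakdown_ledgerGaussian_child_coreClause_tuned_zero Sch (convex_Icc 0 T) hv hω hBS hΓ
    hinit hw hmaps (left_mem_Icc.2 hTpos.le) (right_mem_Icc.2 hs.le) hs13 hz₀ hC

/-! ### §4 The speed face of the Oseen-seeded child, pinned to the Burgers bracket -/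

/-- **THE SPEED FACE OF THE OSEEN-SEEDED CHILD** (any rates `R`, level `k`, `λ > 0`, heat age `a > 0`,
circulation `Γ > 0`, strain time `s` with `λA_k s ≥ 1`): with the hand-over entropy per unit circulation
`K = aλA_k − 1 − log(aλA_k)` (`CoreClock.integral_heatGaussian_mul_log_div`), once
**`0.52·(2K)^{1/4} ≤ δ·e^{λA_k s/4}`** the swirl of the Lundgren child seeded by the planar Oseen run of age `a`
obeys **`‖swirl(s, y)‖ ≤ (0.0563 + δ)·Γ√(λA_k)` at every `y` and `≥ (0.0502 − δ)·Γ√(λA_k)` at some `y`** —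
`palasekTowerBreakdown_cosigned_childSwirl_burgersBracket` with its planar-run hypotheses (`hv`, `hω`, `hBS`,
`h0nn`, `hΓ`) DISCHARGED by `Literature.Analysis.FluidPDE.PlanarLambOseen`. MODEL statement; not about any
registered flow. [cite: GallayWayne2005, §1 (the Oseen vortices, display preceding Thm. 1.2) and §3.4; Saffman1992, §13.3 eq. (31)] -/
theorem palasekTowerBreakdown_oseenRun_childSwirl_burgersBracket (R : TowerRates) (k : ℕ) {l : ℝ}
    (hl : 0 < l) {a Γ : ℝ} (ha : 0 < a) (hΓ : 0 < Γ) {s : ℝ} (hs1 : 1 ≤ l * R.A k * s) {δ : ℝ}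
    (hclock : 0.52 * Real.sqrt (Real.sqrt (2 * (a * (l * R.A k) - 1 - Real.log (a * (l * R.A k))))) ≤
      δ * exp (l * R.A k * s / 4)) :
    (∀ y : EuclideanSpace ℝ (Fin 2),
        ‖exp (l * R.A k * s / 2) •
            PlanarLambOseen.velocity Γ 1 ((exp (l * R.A k * s) - 1) / (l * R.A k) + a)
              (exp (l * R.A k * s / 2) • y)‖ ≤ (0.0563 + δ) * (Γ * Real.sqrt (l * R.A k))) ∧
      ∃ y : EuclideanSpace ℝ (Fin 2),
        (0.0502 - δ) * (Γ * Real.sqrt (l * R.A k)) ≤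
          ‖exp (l * R.A k * s / 2) •
            PlanarLambOseen.velocity Γ 1 ((exp (l * R.A k * s) - 1) / (l * R.A k) + a)
              (exp (l * R.A k * s / 2) • y)‖ := by
  set c : ℝ := l * R.A k with hc
  have hcpos : 0 < c := mul_pos hl (R.A_pos k)
  have hcs : 0 < c * s := by linarith
  have hs : 0 < s := by nlinarith
  set T : ℝ := (exp (c * s) - 1) / c with hT
  have hTpos : 0 < T := by
    rw [hT]
    refine div_pos ?_ hcpos
    have : 1 < exp (c * s) := Real.one_lt_exp_iff.2 hcs
    linarith
  have hv := PlanarLambOseen.isClassicalNSSolutionOn_shift_Icc Γ one_pos ha hTpos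
  have hω := PlanarLambOseen.hasUniformRapidDecayOn_planarVorticity_shift one_pos ha hTpos Γ
  have hBS := PlanarLambOseen.velocity_shift_eq_biotSavart2D_Icc (α := Γ) one_pos ha T
  have h0nn : ∀ η : EuclideanSpace ℝ (Fin 2),
      0 ≤ PlanarEigenmode.vorticity (PlanarLambOseen.velocity Γ 1 (0 + a)) η :=
    PlanarLambOseen.vorticity_shift_zero_nonneg hΓ.le one_pos ha
  have hint : ∫ η, PlanarEigenmode.vorticity (PlanarLambOseen.velocity Γ 1 (0 + a)) η = Γ :=
    PlanarLambOseen.integral_vorticity_shift_zero one_pos ha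
  have hΓ' : 0 < ∫ η, PlanarEigenmode.vorticity (PlanarLambOseen.velocity Γ 1 (0 + a)) η := by
    rw [hint]; exact hΓ
  have hinit : ∀ η : EuclideanSpace ℝ (Fin 2),
      PlanarEigenmode.vorticity (PlanarLambOseen.velocity Γ 1 (0 + a)) η =
        Γ / (4 * π * a) * exp (-(‖η‖ ^ 2 / (4 * a))) := by
    intro η
    rw [PlanarLambOseen.vorticity_shift_zero one_ne_zero a η]
    congr 1
    · ring
    · congr 1; ring
  have hK0 : 0 ≤ a * c - 1 - Real.log (a * c) := by
    have := Real.log_le_sub_one_of_pos (mul_pos ha hcpos)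
    linarith
  have hH₀ : ∫ η, PlanarEigenmode.vorticity (PlanarLambOseen.velocity Γ 1 (0 + a)) η *
      Real.log (PlanarEigenmode.vorticity (PlanarLambOseen.velocity Γ 1 (0 + a)) η /
        ((∫ y, PlanarEigenmode.vorticity (PlanarLambOseen.velocity Γ 1 (0 + a)) y) / (4 * π * c⁻¹) *
          exp (-(‖η‖ ^ 2 / (4 * c⁻¹))))) = Γ * (a * c - 1 - Real.log (a * c)) := by
    rw [hint]
    simp only [hinit]
    rw [integral_heatGaussian_mul_log_div ha (inv_pos.2 hcpos) hΓ, div_inv_eq_mul]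
  have key := palasekTowerBreakdown_cosigned_childSwirl_burgersBracket R k hl (convex_Icc 0 T) hv hω hBS
    (left_mem_Icc.2 hTpos.le) h0nn hΓ' hs1 (right_mem_Icc.2 hTpos.le) (δ := δ) ?_
  · rw [hint] at key
    exact key
  · rw [hH₀, hint]
    have e : Real.sqrt (Real.sqrt (2 * Γ * (Γ * (a * c - 1 - Real.log (a * c))))) =
        Real.sqrt Γ * Real.sqrt (Real.sqrt (2 * (a * c - 1 - Real.log (a * c)))) := by
      rw [show 2 * Γ * (Γ * (a * c - 1 - Real.log (a * c))) = Γ ^ 2 * (2 * (a * c - 1 - Real.log (a * c)))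
          by ring,
        Real.sqrt_mul (sq_nonneg Γ), Real.sqrt_sq hΓ.le, Real.sqrt_mul hΓ.le]
    rw [e]
    have h := mul_le_mul_of_nonneg_left hclock (Real.sqrt_nonneg Γ)
    calc 0.52 * (Real.sqrt Γ * Real.sqrt (Real.sqrt (2 * (a * c - 1 - Real.log (a * c)))))
        = Real.sqrt Γ * (0.52 * Real.sqrt (Real.sqrt (2 * (a * c - 1 - Real.log (a * c))))) := by ring
      _ ≤ Real.sqrt Γ * (δ * exp (c * s / 4)) := h
      _ = δ * Real.sqrt Γ * exp (c * s / 4) := by ring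

/-! ### §5 Every level of the tuned rates: thirteen level-`k` strain units -/

/-- The numeric heart of the all-levels clock: `1600·2^{8.1t} ≤ e^{13t}` for `t ≥ 1`
(`1600·2^{8.1} < 439 040 < e^{13}`, then `t`-th powers). [folklore] -/
private theorem sixteen_hundred_mul_two_rpow_le_exp {t : ℝ} (ht : 1 ≤ t) :
    1600 * (2 : ℝ) ^ ((81 : ℝ) / 10 * t) ≤ exp (13 * t) := by
  have ht0 : 0 ≤ t := zero_le_one.trans ht
  -- `2^{8.1} < 274.4`
  have hxlt : (2 : ℝ) ^ ((81 : ℝ) / 10) < 274.4 := by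
    have hp : ((2 : ℝ) ^ ((81 : ℝ) / 10)) ^ (10 : ℕ) = 2 ^ (81 : ℕ) := by
      rw [← Real.rpow_natCast, ← Real.rpow_mul (by norm_num : (0 : ℝ) ≤ 2)]
      norm_num
    refine lt_of_pow_lt_pow_left₀ 10 (by norm_num) ?_
    rw [hp]; norm_num
  -- `439 040 < e^{13}`
  have hexp : (439040 : ℝ) < exp 13 := by
    have he : (2.7182818283 : ℝ) < exp 1 := Real.exp_one_gt_d9
    have hpow : (2.718 : ℝ) ^ 13 < exp 1 ^ 13 := pow_lt_pow_left₀ (by linarith) (by norm_num) (by norm_num)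
    have h13' : exp 13 = exp 1 ^ 13 := by rw [← Real.exp_nat_mul]; norm_num
    have hnum : (439040 : ℝ) < (2.718 : ℝ) ^ 13 := by norm_num
    linarith
  have hbase : 1600 * (2 : ℝ) ^ ((81 : ℝ) / 10) ≤ exp 13 := by nlinarith [Real.rpow_pos_of_pos two_pos ((81 : ℝ) / 10)]
  have h2pos : 0 < (2 : ℝ) ^ ((81 : ℝ) / 10) := Real.rpow_pos_of_pos two_pos _
  -- `1600 ≤ 1600^t`
  have h1600 : (1600 : ℝ) ≤ 1600 ^ t := by
    calc (1600 : ℝ) = 1600 ^ (1 : ℝ) := (Real.rpow_one _).symm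
      _ ≤ 1600 ^ t := Real.rpow_le_rpow_of_exponent_le (by norm_num) ht
  calc 1600 * (2 : ℝ) ^ ((81 : ℝ) / 10 * t)
      = 1600 * ((2 : ℝ) ^ ((81 : ℝ) / 10)) ^ t := by rw [Real.rpow_mul (by norm_num : (0 : ℝ) ≤ 2)]
    _ ≤ 1600 ^ t * ((2 : ℝ) ^ ((81 : ℝ) / 10)) ^ t :=
        mul_le_mul_of_nonneg_right h1600 (Real.rpow_nonneg h2pos.le t)
    _ = (1600 * (2 : ℝ) ^ ((81 : ℝ) / 10)) ^ t := by rw [Real.mul_rpow (by norm_num) h2pos.le]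
    _ ≤ (exp 13) ^ t := Real.rpow_le_rpow (by positivity) hbase ht0
    _ = exp (13 * t) := by rw [← Real.exp_mul]

/-- **EVERY LEVEL OF THE TUNED RATES: THIRTEEN LEVEL-`k` STRAIN UNITS** (`TowerRates.tuned`, any level `k`,
`λ = 1`, EVERY schedule): the Lundgren child seeded by the planar Oseen run of heat age `a = 1/(2N_{k+1}²)`
(the ledger-width hand-over at level `k`; circulation `Γ > 0`; axial scalar `0`) **meets the level-`(k+1)` core
clause at every strain time `s` with `A_k s ≥ 13·(33/32)^k`, provided `Γ ≥ 0.86·c₁N_{k+1}^{β−2}`** — the log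
clock `1600·x_k ≤ e^{A_k s}` of `palasekTowerBreakdown_ledgerGaussian_child_coreClause_logClock` with
`x_k = N_k^{β−2b} = 2^{8.1·(33/32)^k}` and `1600·2^{8.1t} ≤ e^{13t}` (`t = b^k ≥ 1`), every planar-run
hypothesis discharged by `Literature.Analysis.FluidPDE.PlanarLambOseen`. As a fraction of the level-`k` window
budget `4b²β·log N_k = 169.85·(33/32)^k` strain times this is a LEVEL-INDEPENDENT `7.7 %` — the level-uniform
form relevant to `HeredityFromTwoT` (`k ≥ 2`). MODEL statement; not about any registered flow; no `Stage`
constructed. [cite: GallayWayne2005, §1 (the Oseen vortices, display preceding Thm. 1.2), Lemma 3.2 and §3.4; Palasek2026ElementaryModel, §3 (3.2), §3.1] -/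
theorem palasekTowerBreakdown_oseenRun_child_coreClause_tuned_allLevels (Sch : Schedule TowerRates.tuned)
    (k : ℕ) {Γ : ℝ} (hΓ : 0 < Γ) {s : ℝ} (hs13 : 13 * (33 / 32 : ℝ) ^ k ≤ TowerRates.tuned.A k * s)
    {z₀ : ℝ} (hz₀ : |z₀| ≤ Sch.radius)
    (hC : 0.86 * Sch.c₁ * TowerRates.tuned.N (k + 1) ^ (TowerRates.tuned.β - 2) ≤ Γ) :
    ∃ (x' : EuclideanSpace ℝ (Fin 3)) (γ : ℝ → EuclideanSpace ℝ (Fin 3)),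
      ‖x'‖ ≤ Sch.radius ∧ ContDiff ℝ 1 γ ∧ γ 0 = γ 1 ∧
      (∀ σ ∈ Icc (0 : ℝ) 1, γ σ ∈ Metric.closedBall x' (1 / TowerRates.tuned.N (k + 1))) ∧
      (∀ σ ∈ Icc (0 : ℝ) 1, ‖deriv γ σ‖ ≤ 8 * π / TowerRates.tuned.N (k + 1)) ∧
      Sch.c₁ * TowerRates.tuned.N (k + 1) ^ (TowerRates.tuned.β - 2) ≤
        circulation (velocity (fun _ => 1 * TowerRates.tuned.A k)
          (fun t y => exp (1 * TowerRates.tuned.A k * t / 2) •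
            PlanarLambOseen.velocity Γ 1
              ((exp (1 * TowerRates.tuned.A k * t) - 1) / (1 * TowerRates.tuned.A k) +
                1 / (2 * TowerRates.tuned.N (k + 1) ^ 2))
              (exp (1 * TowerRates.tuned.A k * t / 2) • y))
          (fun t y => exp (-(1 * TowerRates.tuned.A k * t)) •
            (fun (_ : ℝ) (_ : EuclideanSpace ℝ (Fin 2)) => (0 : ℝ))
              ((exp (1 * TowerRates.tuned.A k * t) - 1) / (1 * TowerRates.tuned.A k))
              (exp (1 * TowerRates.tuned.A k * t / 2) • y)) s) γ := by
  have hA := TowerRates.tuned.A_pos k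
  have hN1 := TowerRates.tuned.N_pos (k + 1)
  have hbk : (1 : ℝ) ≤ (33 / 32 : ℝ) ^ k := one_le_pow₀ (by norm_num)
  have hs : 0 < s := by nlinarith
  set c : ℝ := 1 * TowerRates.tuned.A k with hc
  have hcpos : 0 < c := by rw [hc, one_mul]; exact hA
  set a : ℝ := 1 / (2 * TowerRates.tuned.N (k + 1) ^ 2) with ha
  have hapos : 0 < a := by rw [ha]; positivity
  set T : ℝ := (exp (c * s) - 1) / c with hT
  have hTpos : 0 < T := by
    rw [hT]
    refine div_pos ?_ hcpos
    have : 1 < exp (c * s) := Real.one_lt_exp_iff.2 (mul_pos hcpos hs)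
    linarith
  have hmaps : MapsTo (fun t => (exp (c * t) - 1) / c) (Icc 0 s) (Icc 0 T) := mapsTo_lundgrenClock_Icc hcpos
  have hv := PlanarLambOseen.isClassicalNSSolutionOn_shift_Icc Γ one_pos hapos hTpos
  have hω := PlanarLambOseen.hasUniformRapidDecayOn_planarVorticity_shift one_pos hapos hTpos Γ
  have hBS := PlanarLambOseen.velocity_shift_eq_biotSavart2D_Icc (α := Γ) one_pos hapos T
  have hinit : ∀ η : EuclideanSpace ℝ (Fin 2),
      PlanarEigenmode.vorticity (PlanarLambOseen.velocity Γ 1 (0 + a)) η =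
        Γ / (4 * π * (1 / (2 * TowerRates.tuned.N (k + 1) ^ 2))) *
          exp (-(‖η‖ ^ 2 / (4 * (1 / (2 * TowerRates.tuned.N (k + 1) ^ 2))))) := by
    intro η
    rw [PlanarLambOseen.vorticity_shift_zero one_ne_zero a η, ha]
    congr 1
    · ring
    · congr 1; ring
  have hw : IsSmoothSpaceTimeOn (Icc 0 T) (fun (_ : ℝ) (_ : EuclideanSpace ℝ (Fin 2)) => (0 : ℝ)) :=
    contDiffOn_const
  -- `x_k = 2^{8.1·(33/32)^k} ≥ 256`
  have hxeq : 1 * TowerRates.tuned.N k ^ (TowerRates.tuned.β - 2 * TowerRates.tuned.b) =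
      (2 : ℝ) ^ ((81 : ℝ) / 10 * (33 / 32 : ℝ) ^ k) := by
    rw [one_mul, TowerRates.tuned_N_eq_two_rpow, ← Real.rpow_mul (by norm_num : (0 : ℝ) ≤ 2)]
    simp only [TowerRates.tuned]
    ring_nf
  have hx : 1.95 ≤ 1 * TowerRates.tuned.N k ^ (TowerRates.tuned.β - 2 * TowerRates.tuned.b) := by
    have := TowerRates.tuned_coreRatio_ge k
    linarith
  -- the clock: `1600·x_k ≤ e^{13 b^k} ≤ e^{A_k s}`
  have hclock : 1600 * (1 * TowerRates.tuned.N k ^ (TowerRates.tuned.β - 2 * TowerRates.tuned.b)) ≤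
      exp (1 * TowerRates.tuned.A k * s) := by
    rw [hxeq]
    refine (sixteen_hundred_mul_two_rpow_le_exp hbk).trans (exp_le_exp.2 ?_)
    linarith
  exact palasekTowerBreakdown_ledgerGaussian_child_coreClause_logClock TowerRates.tuned Sch k one_pos
    (convex_Icc 0 T) hv hω hBS hΓ hinit hw hmaps (left_mem_Icc.2 hTpos.le) (right_mem_Icc.2 hs.le) hs.le hz₀
    hx hclock hC

end Summit.NavierStokesRegularity.FluidComputer.PalasekTowerClayBridge
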